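import Summits.Ventures.DiscreteObjects.PP12.FixedPointsEqFixedLines

/-!
# Orbit-matrix identities at plane level for a collineation of order 3 (kernel; any finite projective plane)
Framing: lottery ticket; floor = certified bounds/negative ranges.

Cell pub-namedobj (venture DiscreteObjects), target (M), designs gen 13. Every orbit-matrix ('tactical decomposition')
computation of the PP(12) census for a collineation `σ` with `σ³ = 1` (the live `|G| = 3` flag sub-cells `f = 1, 4, 7, 10`,
designs g11/g12 FAMILY-FLAG10/FLAG7, and the typed statement `IsFlagTenOrbitMatrix`, p322607) rests on ONE double-counting
identity, used row by row: for a non-fixed line `b` with orbit `B = {b, σb, σ²b}` and any line `a`,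
`Σ_{b' ∈ B} |a ∩ b'| = 3 + n·[a ∈ B]` (`λ = 1`), and the left-hand side regroups over the points `q` of `a` as
`#{b' ∈ B : q ∈ b'}`, which equals `3·[q ∈ b]` for a fixed point `q` and `|{q, σq, σ²q} ∩ b|` for a non-fixed one.
This file proves exactly that, index-free, for an arbitrary finite projective plane:
* `orb3 τ x = {x, τ x, τ² x}` and its size (`1` or `3` when `τ³ = 1`);
* `card_filter_mem_mapLine` / `card_filter_mem_mapPoint` — incidence counts with a `σ`-stable set are `σ`-invariant;
* `orb3_incidence_symm` — `#{b' ∈ B : p ∈ b'} · |orbit p| = |orbit p ∩ b| · |B|` for every point `p` and line `b`;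
* **`orbit_row_identity`** — for `σ³ = 1`, `σ b ≠ b` and any line `a`:
  `Σ_{q ∈ a} w_b(q) = 3 + n·[a ∈ B]` with `w_b(q) = 3·[q ∈ b]` (`q` fixed) resp. `|orb3 q ∩ b|` (`q` not fixed);
* **`orbit_column_identity`** — the dual statement for a non-fixed point `p` and any point `q`.
Grouping the sum by point orbits turns `orbit_row_identity` into the (R)/(C) equations of FAMILY-FLAG7 §1 for every pair of
row resp. column orbits; the grouping (indexing of the orbits) is the part a reduction such as `FlagTenOrbitReduction` still has
to supply. No `sorry`, no new axioms; nothing here is specific to order 12.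
-/

namespace Summit.Ventures.DiscreteObjects.PP12

open Configuration Finset
open scoped Classical

section Perm

variable {α : Type*}

/-- The `⟨τ⟩`-orbit of `x` for a permutation with `τ ^ 3 = 1`, as the finset `{x, τ x, τ (τ x)}`. -/
noncomputable def orb3 (τ : Equiv.Perm α) (x : α) : Finset α := {x, τ x, τ (τ x)}

/-- membership in `orb3` -/
theorem mem_orb3 (τ : Equiv.Perm α) (x y : α) : y ∈ orb3 τ x ↔ y = x ∨ y = τ x ∨ y = τ (τ x) := by
  simp [orb3]

/-- `x ∈ orb3 τ x` -/
theorem self_mem_orb3 (τ : Equiv.Perm α) (x : α) : x ∈ orb3 τ x := (mem_orb3 τ x x).2 (Or.inl rfl)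

/-- `τ³ = 1` pointwise -/
theorem apply_three (τ : Equiv.Perm α) (h : τ ^ 3 = 1) (x : α) : τ (τ (τ x)) = x := by
  have := congrArg (fun ρ : Equiv.Perm α => ρ x) h
  simpa [pow_succ, Equiv.Perm.mul_apply] using this

/-- `orb3 τ x` is `τ`-stable when `τ³ = 1`. -/
theorem apply_mem_orb3 (τ : Equiv.Perm α) (h : τ ^ 3 = 1) {x y : α} (hy : y ∈ orb3 τ x) : τ y ∈ orb3 τ x := by
  rw [mem_orb3] at hy ⊢
  rcases hy with rfl | rfl | rfl
  · exact Or.inr (Or.inl rfl)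
  · exact Or.inr (Or.inr rfl)
  · exact Or.inl (apply_three τ h x)

/-- every element of `orb3 τ x` is the image of an element of `orb3 τ x` (when `τ³ = 1`) -/
theorem exists_apply_eq_of_mem_orb3 (τ : Equiv.Perm α) (h : τ ^ 3 = 1) {x y : α} (hy : y ∈ orb3 τ x) :
    ∃ z ∈ orb3 τ x, τ z = y :=
  ⟨τ (τ y), apply_mem_orb3 τ h (apply_mem_orb3 τ h hy), apply_three τ h y⟩

/-- the orbit of a fixed point is a singleton -/
theorem orb3_of_fixed (τ : Equiv.Perm α) {x : α} (hx : τ x = x) : orb3 τ x = {x} := by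
  ext y; rw [mem_orb3, hx, hx]; simp

/-- the orbit of a non-fixed point has three elements (`τ³ = 1`) -/
theorem card_orb3_of_ne (τ : Equiv.Perm α) (h : τ ^ 3 = 1) {x : α} (hx : τ x ≠ x) : (orb3 τ x).card = 3 := by
  have h1 : τ (τ x) ≠ x := by
    intro e; apply hx
    have := congrArg τ e; rw [apply_three τ h x] at this; exact this.symm
  have h2 : τ (τ x) ≠ τ x := fun e => hx (τ.injective e)
  have hx1 : x ∉ ({τ x, τ (τ x)} : Finset α) := by
    simp only [mem_insert, mem_singleton, not_or]; exact ⟨fun e => hx e.symm, fun e => h1 e.symm⟩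
  have hx2 : τ x ∉ ({τ (τ x)} : Finset α) := by
    simp only [mem_singleton]; exact fun e => h2 e.symm
  unfold orb3
  rw [card_insert_of_notMem hx1, card_insert_of_notMem hx2, card_singleton]

end Perm

namespace Collineation

variable {P L : Type*} [Membership P L] (σ : Collineation P L)

/-- Incidence counts with a `σ`-stable finite set of points are `σ`-invariant:
`#{q ∈ S : q ∈ σ m} = #{q ∈ S : q ∈ m}`. -/
theorem card_filter_mem_mapLine {S : Finset P} (hS : ∀ q ∈ S, σ.onPoints q ∈ S)
    (hS' : ∀ q ∈ S, ∃ z ∈ S, σ.onPoints z = q) (m : L) :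
    (S.filter fun q => q ∈ σ.onLines m).card = (S.filter fun q => q ∈ m).card := by
  symm
  refine Finset.card_bij (fun q _ => σ.onPoints q) (fun q hq => ?_) (fun q₁ _ q₂ _ e => σ.onPoints.injective e)
    (fun q hq => ?_)
  · rw [mem_filter] at hq ⊢
    exact ⟨hS q hq.1, (σ.mem_iff q m).2 hq.2⟩
  · rw [mem_filter] at hq
    obtain ⟨z, hz, hzq⟩ := hS' q hq.1
    refine ⟨z, ?_, hzq⟩
    rw [mem_filter]
    refine ⟨hz, ?_⟩
    rw [← σ.mem_iff z m, hzq]; exact hq.2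

/-- Dually: `#{m ∈ B : σ p ∈ m} = #{m ∈ B : p ∈ m}` for a `σ`-stable finite set of lines `B`. -/
theorem card_filter_mem_mapPoint {B : Finset L} (hB : ∀ m ∈ B, σ.onLines m ∈ B)
    (hB' : ∀ m ∈ B, ∃ z ∈ B, σ.onLines z = m) (p : P) :
    (B.filter fun m => σ.onPoints p ∈ m).card = (B.filter fun m => p ∈ m).card := by
  symm
  refine Finset.card_bij (fun m _ => σ.onLines m) (fun m hm => ?_) (fun m₁ _ m₂ _ e => σ.onLines.injective e)
    (fun m hm => ?_)
  · rw [mem_filter] at hm ⊢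
    exact ⟨hB m hm.1, (σ.mem_iff p m).2 hm.2⟩
  · rw [mem_filter] at hm
    obtain ⟨z, hz, hzm⟩ := hB' m hm.1
    refine ⟨z, ?_, hzm⟩
    rw [mem_filter]
    refine ⟨hz, ?_⟩
    rw [← σ.mem_iff p z, hzm]; exact hm.2

variable [ProjectivePlane P L] [Fintype P] [Fintype L]

/-- **Incidence symmetry between a point orbit and a line orbit** (`σ³ = 1`): with `Q = orb3 p`, `B = orb3 b`,
`#{b' ∈ B : p ∈ b'} · |Q| = #{q ∈ Q : q ∈ b} · |B|` (both sides count the flags in `Q × B`). -/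
theorem orb3_incidence_symm (hq : σ.onPoints ^ 3 = 1) (p : P) (b : L) :
    ((orb3 σ.onLines b).filter fun b' => p ∈ b').card * (orb3 σ.onPoints p).card
      = ((orb3 σ.onPoints p).filter fun q => q ∈ b).card * (orb3 σ.onLines b).card := by
  have hqL : σ.onLines ^ 3 = 1 := σ.onLines_pow_eq_one hq
  set Q := orb3 σ.onPoints p with hQ
  set B := orb3 σ.onLines b with hBdef
  have hQs : ∀ q ∈ Q, σ.onPoints q ∈ Q := fun q hq' => apply_mem_orb3 _ hq hq'
  have hQs' : ∀ q ∈ Q, ∃ z ∈ Q, σ.onPoints z = q := fun q hq' => exists_apply_eq_of_mem_orb3 _ hq hq'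
  have hBs : ∀ m ∈ B, σ.onLines m ∈ B := fun m hm => apply_mem_orb3 _ hqL hm
  have hBs' : ∀ m ∈ B, ∃ z ∈ B, σ.onLines z = m := fun m hm => exists_apply_eq_of_mem_orb3 _ hqL hm
  -- each point of Q lies on the same number of lines of B
  have key1 : ∀ q ∈ Q, (B.filter fun b' => q ∈ b').card = (B.filter fun b' => p ∈ b').card := by
    intro q hq'
    rw [hQ, mem_orb3] at hq'
    rcases hq' with rfl | rfl | rfl
    · rfl
    · exact σ.card_filter_mem_mapPoint hBs hBs' p
    · rw [σ.card_filter_mem_mapPoint hBs hBs' (σ.onPoints p), σ.card_filter_mem_mapPoint hBs hBs' p]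
  -- each line of B carries the same number of points of Q
  have key2 : ∀ b' ∈ B, (Q.filter fun q => q ∈ b').card = (Q.filter fun q => q ∈ b).card := by
    intro b' hb'
    rw [hBdef, mem_orb3] at hb'
    rcases hb' with rfl | rfl | rfl
    · rfl
    · exact σ.card_filter_mem_mapLine hQs hQs' b
    · rw [σ.card_filter_mem_mapLine hQs hQs' (σ.onLines b), σ.card_filter_mem_mapLine hQs hQs' b]
  -- double count the flags in Q × B
  have flags : ∑ q ∈ Q, (B.filter fun b' => q ∈ b').card = ∑ b' ∈ B, (Q.filter fun q => q ∈ b').card := by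
    simp only [Finset.card_filter]
    exact Finset.sum_comm
  rw [Finset.sum_congr rfl key1, Finset.sum_congr rfl key2, Finset.sum_const, Finset.sum_const, smul_eq_mul,
    smul_eq_mul] at flags
  rw [mul_comm, flags, mul_comm]

/-- The weight of a point `q` against a non-fixed line `b` in the orbit-matrix identities: `3·[q ∈ b]` if `q` is fixed,
`|orb3 q ∩ b|` otherwise. -/
noncomputable def orbWeight (b : L) (q : P) : ℕ :=
  if σ.onPoints q = q then (if q ∈ b then 3 else 0) else ((orb3 σ.onPoints q).filter fun q' => q' ∈ b).card

/-- For `σ³ = 1` and a NON-fixed line `b`: the weight of `q` is the number of lines of the orbit of `b` through `q`. -/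
theorem orbWeight_eq_card (hq : σ.onPoints ^ 3 = 1) {b : L} (hb : σ.onLines b ≠ b) (q : P) :
    σ.orbWeight b q = ((orb3 σ.onLines b).filter fun b' => q ∈ b').card := by
  have hqL : σ.onLines ^ 3 = 1 := σ.onLines_pow_eq_one hq
  have hB : (orb3 σ.onLines b).card = 3 := card_orb3_of_ne _ hqL hb
  have key := σ.orb3_incidence_symm hq q b
  rw [hB] at key
  unfold orbWeight
  split_ifs with hfix hqb
  · rw [orb3_of_fixed _ hfix, card_singleton, mul_one, Finset.filter_singleton, if_pos hqb, card_singleton] at key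
    rw [key]
  · rw [orb3_of_fixed _ hfix, card_singleton, mul_one, Finset.filter_singleton, if_neg hqb, card_empty] at key
    rw [key]
  · rw [card_orb3_of_ne _ hq hfix] at key
    have : ((orb3 σ.onLines b).filter fun b' => q ∈ b').card
        = ((orb3 σ.onPoints q).filter fun q' => q' ∈ b).card := Nat.eq_of_mul_eq_mul_right (by norm_num) key
    exact this.symm

/-- **Orbit row identity** (`λ = 1` summed over a line orbit). For a collineation with `σ³ = 1` on points, a non-fixed
line `b` with orbit `B = {b, σb, σ²b}` and any line `a`:
`Σ_{q ∈ a} orbWeight b q = 3 + n · [a ∈ B]` (that is, `n + 3` if `a ∈ B`, else `3`). -/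
theorem orbit_row_identity (hq : σ.onPoints ^ 3 = 1) {b : L} (hb : σ.onLines b ≠ b) (a : L) :
    ∑ q ∈ univ.filter (fun q : P => q ∈ a), σ.orbWeight b q
      = if a ∈ orb3 σ.onLines b then ProjectivePlane.order P L + 3 else 3 := by
  have hqL : σ.onLines ^ 3 = 1 := σ.onLines_pow_eq_one hq
  set B := orb3 σ.onLines b with hBdef
  have hB : B.card = 3 := card_orb3_of_ne _ hqL hb
  -- Step 1: weights are line counts in B
  rw [Finset.sum_congr rfl (fun q _ => σ.orbWeight_eq_card hq hb q)]
  -- Step 2: Fubini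
  have fub : ∑ q ∈ univ.filter (fun q : P => q ∈ a), (B.filter fun b' => q ∈ b').card
      = ∑ b' ∈ B, (univ.filter fun q : P => q ∈ a ∧ q ∈ b').card := by
    have e1 : ∀ q : P, (B.filter fun b' => q ∈ b').card = ∑ b' ∈ B, (if q ∈ b' then 1 else 0) :=
      fun q => Finset.card_filter _ _
    have e2 : ∀ b' : L, (univ.filter fun q : P => q ∈ a ∧ q ∈ b').card
        = ∑ q ∈ univ.filter (fun q : P => q ∈ a), (if q ∈ b' then 1 else 0) := by
      intro b'
      rw [Finset.card_filter, Finset.sum_filter]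
      refine Finset.sum_congr rfl fun q _ => ?_
      by_cases h1 : q ∈ a <;> by_cases h2 : q ∈ b' <;> simp [h1, h2]
    simp only [e1, e2]
    exact Finset.sum_comm
  rw [fub]
  -- Step 3: two lines meet in one point
  rw [Finset.sum_congr rfl (fun b' _ => card_common_points (P := P) a b')]
  -- Step 4: evaluate
  by_cases ha : a ∈ B
  · rw [if_pos ha, ← Finset.add_sum_erase B _ ha, if_pos rfl]
    have : ∑ x ∈ B.erase a, (if a = x then ProjectivePlane.order P L + 1 else 1) = ∑ x ∈ B.erase a, 1 :=
      Finset.sum_congr rfl fun x hx => by rw [if_neg (Finset.ne_of_mem_erase hx).symm]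
    rw [this, Finset.sum_const, smul_eq_mul, mul_one, Finset.card_erase_of_mem ha, hB]
  · rw [if_neg ha]
    have : ∑ x ∈ B, (if a = x then ProjectivePlane.order P L + 1 else 1) = ∑ x ∈ B, 1 :=
      Finset.sum_congr rfl fun x hx => by rw [if_neg (fun e => ha (by rw [e]; exact hx))]
    rw [this, Finset.sum_const, smul_eq_mul, mul_one, hB]

/-- The special case used most often: two line orbits that are DIFFERENT (`a ∉ B`) give the value `3`. -/
theorem orbit_row_identity_of_not_mem (hq : σ.onPoints ^ 3 = 1) {b : L} (hb : σ.onLines b ≠ b) {a : L}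
    (ha : a ∉ orb3 σ.onLines b) : ∑ q ∈ univ.filter (fun q : P => q ∈ a), σ.orbWeight b q = 3 := by
  rw [σ.orbit_row_identity hq hb a, if_neg ha]

/-- … and a line against its own (non-trivial) orbit gives `n + 3`. -/
theorem orbit_row_identity_self (hq : σ.onPoints ^ 3 = 1) {b : L} (hb : σ.onLines b ≠ b) :
    ∑ q ∈ univ.filter (fun q : P => q ∈ b), σ.orbWeight b q = ProjectivePlane.order P L + 3 := by
  rw [σ.orbit_row_identity hq hb b, if_pos (self_mem_orb3 _ b)]

/-- The dual weight of a line `m` against a non-fixed point `p`: `3·[p ∈ m]` if `m` is fixed, `#{m' ∈ orb3 m : p ∈ m'}` otherwise. -/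
noncomputable def orbCoweight (p : P) (m : L) : ℕ :=
  if σ.onLines m = m then (if p ∈ m then 3 else 0) else ((orb3 σ.onLines m).filter fun m' => p ∈ m').card

/-- **Orbit column identity** (the dual of `orbit_row_identity`): for `σ³ = 1`, a non-fixed point `p` with orbit `Q` and any
point `q`: `Σ_{m ∋ q} orbCoweight p m = 3 + n · [q ∈ Q]`. -/
theorem orbit_column_identity (hq : σ.onPoints ^ 3 = 1) {p : P} (hp : σ.onPoints p ≠ p) (q : P) :
    ∑ m ∈ univ.filter (fun m : L => q ∈ m), σ.orbCoweight p m
      = if q ∈ orb3 σ.onPoints p then ProjectivePlane.order P L + 3 else 3 := by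
  have hqL : σ.onLines ^ 3 = 1 := σ.onLines_pow_eq_one hq
  have h := σ.dual.orbit_row_identity (a := (q : Dual P)) (b := (p : Dual P)) hqL hp
  rw [ProjectivePlane.Dual.order] at h
  exact h

end Collineation

end Summit.Ventures.DiscreteObjects.PP12
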